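import Summits.Ventures.HSemireg.PorteousConfinement
import Literature.NumberTheory.DiophantineGeometry.CafureMateraLemma22ResultantProofs
import Mathlib.LinearAlgebra.Matrix.Rank
import Mathlib.LinearAlgebra.FiniteDimensional.Lemmas

/-!
# Venture HSemireg — SHAPE LEMMA for split Porteous loci at the (S4) rung `n = 6` (and every `n`):
# the rank loci `D_k(φ)` NOT covered by THEOREM N″ are never smooth — residual (R-i)(α) of corner 1

HONEST FRAMING.  Part of the Lean side of the computation cell `pub-hsemireg` (track «S4-PUSH» (ii), lane pen s4-prove-1
g3, note `run/shared/lean/pub/pub-hsemireg/s4push/prove-1/ATTEMPT-6.md`).  ATTEMPT-5 / `PorteousConfinement.lean`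
(THEOREM N″_n, COROLLARY N″_n) treat the CORANK-ONE loci `Z = D_{e−1}(φ)`, `φ : ⊕_{a ≤ e} N_a → ⊕_{i ≤ f} M_i`,
`f = e + n − 1`, and list as KEPT OPEN «(α) other rank loci `D_k`, `k ≤ e − 2`».  This file is the MODEL-LEVEL kernel of
the SHAPE LEMMA that closes (α) for SMOOTH objects: with `r := e − k`, `x := f − k` (so `r·x = n` when `Z` is an
`n`-fold in the `2n`-fold `A`), either `min(r, x) = 1` (THEOREM N″ for `φ` or for its transpose `φ^∨ : F^∨ → E^∨`, which
cuts the same subscheme), or `(r + 1)(x + 1) ≤ 2n` — and then, for `k ≥ 1`, the smaller locus `D_{k−1}(φ)` is NON-EMPTY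
(Fulton–Lazarsfeld; only «`Hom(E,F)` ample» is used, so the lemma holds for non-split `E`, `F` too) and `Z` is
SINGULAR at each of its points (its ideal lies in `m_p²`) — with the single exception
`n = 4`, `(r, x) = (2, 2)` (the `g = 8` door DOOR6 / PS3-1, settled there by s0-3's THEOREM SQ / SQ⁺, not here).  At
the rung `n = 6` the shapes are `(1,6), (6,1)` (N″₆) and `(2,3), (3,2)` (singular): every scheme-smooth split Porteous
6-fold with `k ≥ 1` is N″-shaped; COROLLARY N″₆ — typed in `PorteousConfinement.lean` for `φ` GENERIC with `E^∨ ⊗ F`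
globally generated — then applies to it under N″₆'s own hypotheses (for ARBITRARY `φ` with `Z` scheme-smooth the same
conclusion is a PAPER consequence of N″₆-as-typed + LEMMA (γ′) of ATTEMPT-7.md §2–§3 — genericity enters N″ only through
its set-up, whose products follow from scheme-smoothness; (γ′) is ×2 across seats: s4-prove-1 g6 and s4-ref g9's read
`s4push/VERDICT-PROVE1-REGULARITY-ATTEMPT7-2026-08-23.md`; its local-algebra step is `PorteousShapesRegularity.lean`;
docstring corrected after s4-ref's read O-1, `s4push/VERDICT-PROVE1-PORTEOUSSHAPES-2026-08-23.md`).  PRIOR RECORD: for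
GENERAL `φ` the singularity of the
`(2,3)/(3,2)` types at `n = 6` is one sentence of `step0/C/DOOR6-SQ-s0-3.md` §2c («`D_{e−r−1}` = finitely many points …
so `Z` is singular there and SQ is silent»); this file's route (Fulton–Lazarsfeld, EVERY `φ`) removes the genericity
qualifier and kernel-checks the local algebra — a second derivation across seats, not a first.
Nothing here constructs a variety, a degeneracy locus or a Weil class; nothing here says that HC / HC_CM / HC_AV holds;
no Literature fact is declared; NEGATIVE #12's signed text (g = 6) does not move.

PROVED HERE (kernel):
* §1 SHAPE ARITHMETIC: `fl_bound_iff` (`r x = n`, `r, x ≥ 2`: `(r+1)(x+1) ≤ 2n ↔ (r, x) ≠ (2, 2)`),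
  `corank_one_or_square` (escaping the Fulton–Lazarsfeld bound forces `min(r,x) = 1` or the square shape at `n = 4`),
  the rungs `shapes_six` / `rung_six` (`n = 6`), `rung_three` (`g = 6`: no shape beyond N″ and its transpose),
  `rung_four_square` (`n = 4`: the square shape escapes).
* §2 MINORS AT A LOW-RANK POINT: `minor_det_mem_sq` — over a `K`-algebra `A` with an ideal `I` (the local ring of `A` at
  `p` and `m_p`), if `Φ ≡ Φ₀ (mod I)` entrywise with `Φ₀` a `K`-matrix of rank `≤ t − 2`, EVERY `t × t` minor of `Φ` lies
  in `I²`; `minor_succ_det_mem_sq` is the instance «rank `Φ(p) ≤ k − 1` ⇒ all `(k+1)`-minors `∈ m_p²`», i.e. the ideal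
  of `D_k(φ)` at a point of `D_{k−1}(φ)` lies in `m_p²` (Zariski tangent space `= T_pA`).  Read contrapositively, for ANY
  `φ`: `D_k(φ)` smooth of dimension `< dim A` ⇒ `D_{k−1}(φ) = ∅` — so THEOREM N″'s set-up hypothesis «`D_{e−2}(φ) = ∅`»
  follows from the smoothness of `Z = D_{e−1}(φ)` alone (genericity of `φ` is not needed for it).
* §3 TRANSPOSE: `rank_transpose_le_iff`, `det_submatrix_transpose` — `D_k(φ) = D_k(φ^∨)` pointwise and minor by minor
  (the `(x, 1)` shapes are THEOREM N″ for `φ^∨`; `transpose_shape` is the rank bookkeeping `f' = e' + n − 1`).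
* §4 GIAMBELLI READ-OUT: `det_mem_span_pow_of_graded` (a determinant with `(i,j)` entry in `K∙h^{a_i + b_j}` lies in
  `K∙h^{Σa + Σb}`) and `giambelli_rect_mem_span_pow`: with all letters in `K∙h`, the Thom–Porteous class
  `[D_k(φ′)] = Δ^{(r)}_{(x)}(c(F′ − E′)) = det(c_{x+j−i})` lies in `K∙h^{r x}` — the class read-out for EVERY shape
  (`r ≤ x + 1`), e.g. `c₃² − c₂c₄ ∈ K∙h⁶` for `(2,3)`; so the singular shapes are W-dead as soon as something forces
  their letters into `ℚh` (for them the N″ mechanism is NOT available: recorded, not claimed).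
* §5 ASSEMBLY at the rung: `smooth_shape_rung_six`.

NOT LEAN (paper, ATTEMPT-6.md §1–§2; named where they enter): Fulton–Lazarsfeld non-emptiness «`Hom(E,F)` ample and
`dim X ≥ (e−k)(f−k)` ⇒ `D_k(σ) ≠ ∅` for every `σ`» (Fulton, Intersection Theory, Example 12.1.6 with Theorem 12.1 (d);
Fulton–Lazarsfeld, Acta Math. 146 (1981)); «a direct sum of ample bundles is ample» (ibid. §12.1); «the ideal of
`D_k(φ)` is generated by the `(k+1)`-minors» (the definition, Fulton §14.4); «`I_{Z,p} ⊆ m_p²` and `dim_p Z < dim A` ⇒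
`Z` not smooth at `p`» (Zariski tangent space); Thom–Porteous / Giambelli `[D_k(σ)] = Δ^{(e−k)}_{(f−k)}(c(F − E))`
(Fulton Thm 14.4); and everything already listed as NOT LEAN in `PorteousConfinement.lean`.  References (dictionary only; bib keys
`Fulton1998` §12.1 / §14.4, `FultonLazarsfeld1981`): ATTEMPT-5.md §5 (α); ATTEMPT-6.md; TH5-PORTEOUS-LEMMA-N.md §5 REMARK N‴
(the transpose «resolves through a Grassmannian … NOT covered» — said there of split `E` with NON-split `F`).
-/

open scoped BigOperators
open Finset

namespace Summit.Ventures.HSemireg.PorteousShapes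

/-! ## §1 Shape arithmetic: `r = e − k` (kernel rank), `x = f − k` (cokernel rank), `r·x = n = dim Z = ½ dim A` -/

section Shapes

/-- **The Fulton–Lazarsfeld bound.**  For a shape `(r, x)` with `r x = n` and `r, x ≥ 2`, the expected codimension
`(r+1)(x+1)` of the smaller locus `D_{k−1}` is at most `dim A = 2n` — so `D_{k−1}(φ) ≠ ∅` by Fulton–Lazarsfeld —
exactly when `(r, x) ≠ (2, 2)`. -/
theorem fl_bound_iff {r x n : ℕ} (hn : r * x = n) (hr : 2 ≤ r) (hx : 2 ≤ x) :
    (r + 1) * (x + 1) ≤ 2 * n ↔ ¬ (r = 2 ∧ x = 2) := by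
  subst hn
  constructor
  · rintro h ⟨rfl, rfl⟩
    omega
  · intro h
    by_cases h2 : r = 2
    · subst h2
      have hx3 : 3 ≤ x := by omega
      nlinarith
    · obtain ⟨r', rfl⟩ : ∃ r', r = r' + 3 := ⟨r - 3, by omega⟩
      obtain ⟨x', rfl⟩ : ∃ x', x = x' + 2 := ⟨x - 2, by omega⟩
      nlinarith [Nat.zero_le (r' * x')]

/-- **Escaping the bound forces corank one (or the square shape at `n = 4`).**  If `r x = n`, `r, x ≥ 1`, and the
Fulton–Lazarsfeld bound FAILS (`2n < (r+1)(x+1)`, the only way `D_{k−1}(φ)` can be empty), then `r = 1` or `x = 1`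
(THEOREM N″ for `φ` or for `φ^∨`) or `(r, x, n) = (2, 2, 4)`. -/
theorem corank_one_or_square {r x n : ℕ} (hn : r * x = n) (hr : 1 ≤ r) (hx : 1 ≤ x)
    (hfl : 2 * n < (r + 1) * (x + 1)) : r = 1 ∨ x = 1 ∨ (r = 2 ∧ x = 2 ∧ n = 4) := by
  by_cases hr1 : r = 1
  · exact Or.inl hr1
  by_cases hx1 : x = 1
  · exact Or.inr (Or.inl hx1)
  have hr2 : 2 ≤ r := by omega
  have hx2 : 2 ≤ x := by omega
  have hsq : r = 2 ∧ x = 2 := by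
    by_contra hne
    have := (fl_bound_iff hn hr2 hx2).2 hne
    omega
  obtain ⟨rfl, rfl⟩ := hsq
  exact Or.inr (Or.inr ⟨rfl, rfl, by omega⟩)

/-- The shapes at the rung `n = 6`: `r x = 6` iff `(r, x) ∈ {(1,6), (2,3), (3,2), (6,1)}`. -/
theorem shapes_six {r x : ℕ} : r * x = 6 ↔ (r = 1 ∧ x = 6) ∨ (r = 2 ∧ x = 3) ∨ (r = 3 ∧ x = 2) ∨ (r = 6 ∧ x = 1) := by
  constructor
  · intro h
    have hr : r ≤ 6 := by
      rcases Nat.eq_zero_or_pos x with hx | hx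
      · subst hx; simp at h
      · nlinarith
    interval_cases r <;> omega
  · rintro (⟨rfl, rfl⟩ | ⟨rfl, rfl⟩ | ⟨rfl, rfl⟩ | ⟨rfl, rfl⟩) <;> norm_num

/-- **Rung `n = 6`.**  Every shape with `r, x ≥ 2` — i.e. `(2,3)` and `(3,2)` — satisfies the Fulton–Lazarsfeld bound
with equality: the expected codimension of `D_{k−1}` is `3 · 4 = 12 = dim A`. -/
theorem rung_six {r x : ℕ} (h : r * x = 6) (hr : 2 ≤ r) (hx : 2 ≤ x) : (r + 1) * (x + 1) = 2 * 6 := by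
  rcases shapes_six.1 h with ⟨rfl, rfl⟩ | ⟨rfl, rfl⟩ | ⟨rfl, rfl⟩ | ⟨rfl, rfl⟩ <;> omega

/-- **Rung `n = 3` (`g = 6`, NEGATIVE #12's level).**  `3` is prime: there is no shape beyond N″ (`r = 1`) and its
transpose (`x = 1`). -/
theorem rung_three {r x : ℕ} (h : r * x = 3) : r = 1 ∨ x = 1 := by
  have hr : r ≤ 3 := by
    rcases Nat.eq_zero_or_pos x with hx | hx
    · subst hx; simp at h
    · nlinarith
  interval_cases r <;> omega

/-- **Rung `n = 4` (`g = 8`).**  The only shape with `r, x ≥ 2` is the square `(2, 2)`, and it ESCAPES the bound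
(`9 > 8`: `D_{k−1}` has negative expected dimension): square split Porteous 4-folds in 8-folds are not excluded by the
shape lemma and are not N″-shaped — they are the `g = 8` census door DOOR6 / PS3-1, treated THERE (s0-3's THEOREM SQ for
trivial source, SQ⁺/SQ″ for split sources under an extra ampleness hypothesis (H1*); `step0/C/DOOR6-SQ-s0-3.md`), not
by this file. -/
theorem rung_four_square {r x : ℕ} (h : r * x = 4) (hr : 2 ≤ r) (hx : 2 ≤ x) :
    r = 2 ∧ x = 2 ∧ 2 * 4 < (r + 1) * (x + 1) := by
  have hr4 : r ≤ 4 := by nlinarith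
  interval_cases r <;> omega

/-- For every `n ≠ 4`, a shape with `r, x ≥ 2` and `r x = n` satisfies the Fulton–Lazarsfeld bound. -/
theorem fl_bound_of_ne_four {r x n : ℕ} (hn : r * x = n) (hr : 2 ≤ r) (hx : 2 ≤ x) (h4 : n ≠ 4) :
    (r + 1) * (x + 1) ≤ 2 * n := by
  refine (fl_bound_iff hn hr hx).2 ?_
  rintro ⟨rfl, rfl⟩
  omega

end Shapes

/-! ## §2 Minors at a point of lower rank lie in the square of the maximal ideal -/

section Minors

variable {K A : Type*} [Field K] [CommRing A] [Algebra K A]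
variable {m n : Type*} [Fintype n]

/-- **Minors at a low-rank point.**  Let `Φ` be a matrix over a `K`-algebra `A` (the local ring `𝒪_{A,p}`), congruent
entrywise modulo the ideal `I` (the maximal ideal `m_p`) to the constant matrix `Φ₀ = Φ(p)` over `K`.  If
`rank Φ₀ ≤ t − 2`, then EVERY `t × t` minor of `Φ` lies in `I²`: the constant part of the minor is a `t × t` matrix
of rank `≤ t − 2`, which kills two independent vectors, and a determinant with two columns in `I` (after a constant
change of basis) lies in `I²` (`det_mem_pow_of_linearIndependent`). -/
theorem minor_det_mem_sq (I : Ideal A) (Φ : Matrix m n A) (Φ₀ : Matrix m n K)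
    (hΦ : ∀ i j, Φ i j - algebraMap K A (Φ₀ i j) ∈ I) {t : ℕ} (rows : Fin t → m) (cols : Fin t → n)
    (hrank : Φ₀.rank + 2 ≤ t) : (Φ.submatrix rows cols).det ∈ I ^ 2 := by
  classical
  set M₀ : Matrix (Fin t) (Fin t) K := Φ₀.submatrix rows cols with hM₀def
  have hM₀ : M₀.rank + 2 ≤ t := le_trans (Nat.add_le_add_right (Matrix.rank_submatrix_le Φ₀ rows cols) 2) hrank
  have hker : 2 ≤ Module.finrank K (LinearMap.ker M₀.mulVecLin) := by
    have h1 := LinearMap.finrank_range_add_finrank_ker M₀.mulVecLin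
    rw [Module.finrank_fin_fun] at h1
    have h2 : M₀.rank = Module.finrank K (LinearMap.range M₀.mulVecLin) := rfl
    omega
  let b := Module.finBasis K (LinearMap.ker M₀.mulVecLin)
  let v : Fin 2 → (Fin t → K) := fun l => ((b (Fin.castLE hker l) : LinearMap.ker M₀.mulVecLin) : Fin t → K)
  have hv : LinearIndependent K v :=
    (b.linearIndependent.comp (Fin.castLE hker) (Fin.castLE_injective hker)).map'
      (LinearMap.ker M₀.mulVecLin).subtype (Submodule.ker_subtype _)
  have hv0 : ∀ l, M₀.mulVec (v l) = 0 := fun l => by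
    have hmem := (b (Fin.castLE hker l)).2
    rwa [LinearMap.mem_ker, Matrix.mulVecLin_apply] at hmem
  have key := Literature.NumberTheory.DiophantineGeometry.CafureMateraLemma22.det_mem_pow_of_linearIndependent I
    (Φ.submatrix rows cols) M₀ (fun i j => hΦ _ _) v hv hv0
  simpa using key

/-- **The ideal of `D_k(φ)` at a point of `D_{k−1}(φ)` lies in `m_p²`.**  If `rank Φ(p) ≤ k − 1` (stated as
`rank Φ₀ + 1 ≤ k`), every `(k+1) × (k+1)` minor of `Φ` lies in `I²`; the `(k+1)`-minors generate the ideal of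
`D_k(φ)`, so `I_{D_k(φ), p} ⊆ m_p²`, the Zariski tangent space of `D_k(φ)` at `p` is all of `T_pA`, and `D_k(φ)` is
not smooth at `p` as soon as `dim D_k(φ) < dim A` (paper: Zariski tangent space). -/
theorem minor_succ_det_mem_sq (I : Ideal A) (Φ : Matrix m n A) (Φ₀ : Matrix m n K)
    (hΦ : ∀ i j, Φ i j - algebraMap K A (Φ₀ i j) ∈ I) {k : ℕ} (hrank : Φ₀.rank + 1 ≤ k)
    (rows : Fin (k + 1) → m) (cols : Fin (k + 1) → n) : (Φ.submatrix rows cols).det ∈ I ^ 2 :=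
  minor_det_mem_sq I Φ Φ₀ hΦ rows cols (by omega)

end Minors

/-! ## §3 Transpose: `D_k(φ) = D_k(φ^∨)` — the `(x, 1)` shapes are THEOREM N″ for `φ^∨ : F^∨ → E^∨` -/

section Transpose

/-- Pointwise: `rank φ(p)ᵀ ≤ k ↔ rank φ(p) ≤ k`, so `D_k(φ)` and `D_k(φ^∨)` have the same support. -/
theorem rank_transpose_le_iff {K : Type*} [Field K] {m n : Type*} [Fintype m] [Fintype n] (Φ : Matrix m n K)
    (k : ℕ) : Φ.transpose.rank ≤ k ↔ Φ.rank ≤ k := by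
  rw [Matrix.rank_transpose]

/-- Minor by minor: the `t × t` minors of `φᵀ` are those of `φ`, so the Fitting ideals — the SCHEME structures of
`D_k(φ)` and `D_k(φ^∨)` — coincide, and «`Z ⊂ A` deforms along `ξ`» is the same question for both. -/
theorem det_submatrix_transpose {A : Type*} [CommRing A] {m n : Type*} (Φ : Matrix m n A) {t : ℕ}
    (rows : Fin t → m) (cols : Fin t → n) :
    (Φ.transpose.submatrix cols rows).det = (Φ.submatrix rows cols).det := by
  rw [← Matrix.transpose_submatrix, Matrix.det_transpose]

/-- Rank bookkeeping of the transpose: a shape with `x = f − k = 1` and `r = e − k = n` is THEOREM N″_n's shape for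
`φ^∨ : F^∨ → E^∨` — source rank `e' = f = k + 1` (so `k = e' − 1`, corank one) and target rank `f' = e = e' + n − 1`. -/
theorem transpose_shape {e f k n : ℕ} (hx : f = k + 1) (hr : e = k + n) : k = f - 1 ∧ e = f + n - 1 := by
  subst hx; subst hr; omega

end Transpose

/-! ## §4 The Giambelli / Thom–Porteous class read-out for every shape -/

section Giambelli

open PowerSeries PorteousConfinement

variable {K : Type*} [CommRing K] {R : Type*} [CommRing R] [Algebra K R]

/-- A product of elements `y_i ∈ K∙h^{d_i}` lies in `K∙h^{Σ d_i}`. -/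
theorem prod_mem_span_pow {ι : Type*} (s : Finset ι) {h : R} {y : ι → R} {d : ι → ℕ}
    (hy : ∀ i ∈ s, y i ∈ K ∙ h ^ d i) : ∏ i ∈ s, y i ∈ K ∙ h ^ (∑ i ∈ s, d i) := by
  classical
  induction s using Finset.induction_on with
  | empty => simp
  | insert a s ha ih =>
    rw [Finset.prod_insert ha, Finset.sum_insert ha]
    exact mul_mem_span_pow (hy a (by simp)) (ih fun i hi => hy i (by simp [hi]))

/-- **Graded determinants.**  If the `(i, j)` entry of a square matrix lies in `K∙h^{a_i + b_j}`, its determinant lies in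
`K∙h^{Σ_i a_i + Σ_j b_j}` (Leibniz: every term is a product over a permutation, and `Σ_i (a_{σ i} + b_i)` does not
depend on `σ`). -/
theorem det_mem_span_pow_of_graded {t : ℕ} {h : R} (M : Matrix (Fin t) (Fin t) R) (a b : Fin t → ℕ)
    (hM : ∀ i j, M i j ∈ K ∙ h ^ (a i + b j)) : M.det ∈ K ∙ h ^ (∑ i, a i + ∑ j, b j) := by
  rw [Matrix.det_apply']
  refine Submodule.sum_mem _ fun σ _ => ?_
  have hprod : ∏ i, M (σ i) i ∈ K ∙ h ^ (∑ i, (a (σ i) + b i)) :=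
    prod_mem_span_pow Finset.univ fun i _ => hM (σ i) i
  have hsum : ∑ i, (a (σ i) + b i) = ∑ i, a i + ∑ j, b j := by
    rw [Finset.sum_add_distrib, Equiv.sum_comp σ a]
  rw [hsum] at hprod
  rw [← zsmul_eq_mul]
  exact zsmul_mem hprod _

/-- **Giambelli read-out for a rectangular shape.**  With all letters of `E′`, `F′` in `K∙h` and `Φ = c(F′ − E′)` (any
`Φ` with `Φ · c(E′) = c(F′)`), the Thom–Porteous class of the shape `(r, x)` (kernel rank `r`, cokernel rank `x`,
`r ≤ x + 1` so that all indices are natural), `Δ^{(r)}_{(x)}(c(F′ − E′)) = det(c_{x + j − i}(F′ − E′))_{i,j < r}`,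
lies in `K∙h^{r·x}` — for `(1, n)` this is `c_n ∈ K∙hⁿ` (COROLLARY N″), for `(2, 3)` it is `c₃² − c₂c₄ ∈ K∙h⁶`. -/
theorem giambelli_rect_mem_span_pow {e f : ℕ} {l : Fin e → R} {m : Fin f → R} {h : R}
    (hl : ∀ a, l a ∈ K ∙ h) (hm : ∀ i, m i ∈ K ∙ h) {Φ : R⟦X⟧} (hΦ : Φ * chernSplit l = chernSplit m)
    (r x : ℕ) (hrx : r ≤ x + 1) :
    (Matrix.of fun i j : Fin r => coeff (x + (j : ℕ) - (i : ℕ)) Φ).det ∈ K ∙ h ^ (r * x) := by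
  have hc := coeff_virtualChern_mem_span_pow hl hm hΦ
  have key := det_mem_span_pow_of_graded (K := K) (h := h)
    (Matrix.of fun i j : Fin r => coeff (x + (j : ℕ) - (i : ℕ)) Φ) (fun i => x - (i : ℕ)) (fun j => (j : ℕ))
    (fun i j => by
      have hi : (i : ℕ) ≤ x := by have := i.2; omega
      rw [Matrix.of_apply, show x + (j : ℕ) - (i : ℕ) = x - (i : ℕ) + (j : ℕ) by omega]
      exact hc _)
  have hexp : ∑ i : Fin r, (x - (i : ℕ)) + ∑ j : Fin r, (j : ℕ) = r * x := by
    have h1 : ∀ i : Fin r, (x - (i : ℕ)) + (i : ℕ) = x := fun i => by have := i.2; omega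
    have h2 : ∑ i : Fin r, ((x - (i : ℕ)) + (i : ℕ)) = ∑ _i : Fin r, x := Finset.sum_congr rfl fun i _ => h1 i
    rw [Finset.sum_add_distrib] at h2
    rw [h2, Finset.sum_const, Finset.card_univ, Fintype.card_fin, smul_eq_mul]
  rwa [hexp] at key

/-- The `(2, 3)` instance spelled out: `c₃² − c₂ c₄ ∈ K∙h⁶` (the class of the singular `(2,3)`-loci at the rung `n = 6`,
should anything force their letters into `ℚh`; the N″ mechanism itself is not available for them). -/
theorem giambelli_two_three_mem {e f : ℕ} {l : Fin e → R} {m : Fin f → R} {h : R}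
    (hl : ∀ a, l a ∈ K ∙ h) (hm : ∀ i, m i ∈ K ∙ h) {Φ : R⟦X⟧} (hΦ : Φ * chernSplit l = chernSplit m) :
    coeff 3 Φ * coeff 3 Φ - coeff 2 Φ * coeff 4 Φ ∈ K ∙ h ^ 6 := by
  have hc := coeff_virtualChern_mem_span_pow hl hm hΦ
  have h33 := mul_mem_span_pow (hc 3) (hc 3)
  have h24 := mul_mem_span_pow (hc 2) (hc 4)
  exact Submodule.sub_mem _ h33 h24

end Giambelli

/-! ## §5 Assembly at the rung `n = 6` -/

section Assembly

/-- **SHAPE LEMMA at the rung `n = 6` (the typed sentence).**  For every shape `(r, x)` of a split Porteous 6-fold in a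
12-fold (`r x = 6`): either `min(r, x) = 1` — THEOREM N″₆ for `φ` (`r = 1`) or for `φ^∨` (`x = 1`) — or the
Fulton–Lazarsfeld bound holds with equality, `(r+1)(x+1) = 12 = dim A`, so that for `k ≥ 1` the locus `D_{k−1}(φ)`
is non-empty for EVERY `φ` (paper: Fulton Ex. 12.1.6) and `D_k(φ)` is singular there (§2 + Zariski tangent space):
no smooth split Porteous 6-fold of shape `(2,3)` or `(3,2)` exists. -/
theorem smooth_shape_rung_six {r x : ℕ} (h : r * x = 6) :
    (r = 1 ∨ x = 1) ∨ (2 ≤ r ∧ 2 ≤ x ∧ (r + 1) * (x + 1) = 2 * 6) := by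
  rcases shapes_six.1 h with ⟨rfl, rfl⟩ | ⟨rfl, rfl⟩ | ⟨rfl, rfl⟩ | ⟨rfl, rfl⟩
  · exact Or.inl (Or.inl rfl)
  · exact Or.inr ⟨le_rfl, by norm_num, by norm_num⟩
  · exact Or.inr ⟨by norm_num, le_rfl, by norm_num⟩
  · exact Or.inl (Or.inr rfl)

/-- **SHAPE LEMMA, every rung `n ≠ 4`.**  A shape either has corank one on one side (N″ / transpose) or satisfies the
Fulton–Lazarsfeld bound (singular for `k ≥ 1`). -/
theorem smooth_shape_of_ne_four {r x n : ℕ} (hn : r * x = n) (hr : 1 ≤ r) (hx : 1 ≤ x) (h4 : n ≠ 4) :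
    (r = 1 ∨ x = 1) ∨ (r + 1) * (x + 1) ≤ 2 * n := by
  by_cases hfl : (r + 1) * (x + 1) ≤ 2 * n
  · exact Or.inr hfl
  · rcases corank_one_or_square hn hr hx (by omega) with h1 | h1 | ⟨-, -, h44⟩
    · exact Or.inl (Or.inl h1)
    · exact Or.inl (Or.inr h1)
    · exact absurd h44 h4

end Assembly

end Summit.Ventures.HSemireg.PorteousShapes
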